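import Mathlib
import Summits.NavierStokesRegularity.NavierStokesRegularity.Theorems.RootDecompLitSliceCubicFluxAssembled
import Summits.NavierStokesRegularity.NavierStokesRegularity.Theorems.RootDecompLitSlicePressureGauge
import Summits.NavierStokesRegularity.NavierStokesRegularity.Theorems.RootDecompLitSlicePressureFlux
import HarnessLib

/-!
# Route RootDecompLitSlice — cell Uᶜ `CritTameScarIsCritical` (stmt-NavierStokesRegularity-31733):
# the UNIFORM SCAR LAW on a terminal window — every number discharged

Helper toward the Tao-vacuous cell Uᶜ (`--supports 31733`; no item, no node, no registered stub).
The landed `LocalEnergyBudget.scar_le_of_pressureBudget` bounds the scar `∫_{B(x₀,r)}|u(T)|²` by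
the window level `2H`, the local release, the Laplacian and cubic-flux budgets and a PRESSURE FLUX
number `mpu` with its integrability companion. Here `mpu` is discharged from frame data alone:
the classical pressure is the associated `L^{3/2}` pressure up to a gauge
(`PressureGauge.exists_gauge_associated_pressure`, landed) and the global Stein bound gives
`∬|p − c(t)||u| ≤ C_{3/2} K^{3/2} ‖u₀‖₂ A^{1/4} τ^{1/4} (‖u₀‖₂√H/ν)^{3/4}`
(`PressureFlux.pressureFlux_le`, landed, with `G ≤ ‖u₀‖₂√H/ν` from
`CubicFlux.windowEnstrophy_le_of_modulus`).

* ★ `LocalEnergyBudget.scar_le_uniform` — for `ν > 0`, a classical solution on `[0,T) × ℝ³` that is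
  Leray–Hopf from decaying data, any centre `x₀`, radii `0 < r`, `4r ≤ ρ`, `R`, a window `τ < T`
  with modulus `∫⁻‖u(t) − u(T)‖ₑ² ≤ H` on `[T−τ,T)`, and any smooth cutoff `φ` (`= 1` on `B_ρ`,
  support in `B_R`, `|∇φ| ≤ Cg`, `|Δφ| ≤ CL`):
  `∫_{B_r}|u(T)|² ≤ 2H + 16 (r²/(ντ)) · (Rel + ν·CL·A·τ + Cg·M₃ + 2Cg·M_p)/2 + c₀ (r/ρ)² (H + ∫_{B_ρ}|u(T)|²)`
  with `A = (√H + √(∫_{B_R}|u(T)|²))²`, `Rel = 4H + 4√H√(2H + 2∫_{B_R}|u(T)|²)`,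
  `M₃ = K₀ A^{3/4} τ^{1/4} (‖u₀‖₂√H/ν)^{3/4}`, `M_p = K₁ ‖u₀‖₂ A^{1/4} τ^{1/4} (‖u₀‖₂√H/ν)^{3/4}`
  and ABSOLUTE constants `c₀, K₀, K₁ ≥ 0` — no hypothesis number left except the modulus level `H`.

HONEST FRAMING: a helper INSIDE the Tao-vacuous cell Uᶜ; zero load of the route moves
(ROOT ⟺ U ∧ P1, critic rows 354/371/563/639/665/678); no item is re-typed. Rung 0: nothing here
proves NS regularity; with the `b`-clock `H = Kτ^b` this is the kernel form of the crude
(global-pressure) tier of the clock → scar bookkeeping, which cannot reach the endpoint `b = 1/2`.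
Decomp-ns route-writer g40. [cite: CaffarelliKohnNirenberg1982, §2 eq. (2.4)]
-/

set_option linter.dupNamespace false

noncomputable section

namespace Summit.NavierStokesRegularity.NavierStokesRegularity.Theorems

open MeasureTheory TopologicalSpace Set Function Filter Metric
open _root_.Topology
open scoped Laplacian InnerProductSpace RealInnerProductSpace ENNReal NNReal ContDiff
open Literature.Analysis.FluidPDE

namespace LocalEnergyBudget

/-- ★ **THE UNIFORM SCAR LAW on a terminal window** (all flux numbers discharged; see the module
docstring for the shape). [cite: CaffarelliKohnNirenberg1982, §2 eq. (2.4)] -/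
theorem scar_le_uniform : ∃ c₀ K₀ K₁ : ℝ, 0 ≤ c₀ ∧ 0 ≤ K₀ ∧ 0 ≤ K₁ ∧
    ∀ (ν T : ℝ), 0 < ν → 0 < T →
    ∀ (u : ℝ → EuclideanSpace ℝ (Fin 3) → EuclideanSpace ℝ (Fin 3))
      (p : ℝ → EuclideanSpace ℝ (Fin 3) → ℝ),
      IsClassicalNSSolutionOn (Set.Ico 0 T) ν 0 u p →
      IsLerayHopfOn T ν 0 (u 0) u →
      HasRapidSpatialDecay (u 0) →
      ∀ (x₀ : EuclideanSpace ℝ (Fin 3)) (r ρ R τ H : ℝ),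
        0 < r → 4 * r ≤ ρ → 0 < τ → τ < T → 0 ≤ H →
        (∀ t ∈ Set.Ico (T - τ) T, ∫⁻ x, ‖u t x - u T x‖ₑ ^ 2 ≤ ENNReal.ofReal H) →
        ∀ (φ : EuclideanSpace ℝ (Fin 3) → ℝ) (Cg CL : ℝ), ContDiff ℝ ∞ φ → HasCompactSupport φ →
          (∀ x, 0 ≤ φ x) → (∀ x, φ x ≤ 1) → (∀ x ∈ ball x₀ ρ, φ x = 1) →
          tsupport φ ⊆ ball x₀ R → (∀ x, ‖fderiv ℝ φ x‖ ≤ Cg) → (∀ x, |(Δ φ) x| ≤ CL) → 0 ≤ Cg →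
        ∫ x in ball x₀ r, ‖u T x‖ ^ 2 ≤
          2 * H + 16 * (r ^ 2 / (ν * τ)) *
              ((4 * H + 4 * Real.sqrt H * Real.sqrt (2 * H + 2 * ∫ x in ball x₀ R, ‖u T x‖ ^ 2) +
                (ν * CL * ((Real.sqrt H + Real.sqrt (∫ x in ball x₀ R, ‖u T x‖ ^ 2)) ^ 2) * τ +
                  Cg * (K₀ * ((Real.sqrt H + Real.sqrt (∫ x in ball x₀ R, ‖u T x‖ ^ 2)) ^ 2) ^
                      (3 / 4 : ℝ) * (τ ^ (1 / 4 : ℝ) *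
                        (Real.sqrt (∫ x, ‖u 0 x‖ ^ 2) * Real.sqrt H / ν) ^ (3 / 4 : ℝ))) +
                  2 * Cg * (K₁ * Real.sqrt (∫ x, ‖u 0 x‖ ^ 2) *
                    ((Real.sqrt H + Real.sqrt (∫ x in ball x₀ R, ‖u T x‖ ^ 2)) ^ 2) ^ (1 / 4 : ℝ) *
                      (τ ^ (1 / 4 : ℝ) *
                        (Real.sqrt (∫ x, ‖u 0 x‖ ^ 2) * Real.sqrt H / ν) ^ (3 / 4 : ℝ))))) / 2) +
            c₀ * (r / ρ) ^ 2 * (H + ∫ x in ball x₀ ρ, ‖u T x‖ ^ 2) := by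
  obtain ⟨c₀, K₀, hc₀, hK₀, hB⟩ := scar_le_of_pressureBudget
  set K₁ : ℝ := (steinConstThreeHalves : ℝ) *
    ((SNormLESNormFDerivOfEqConst (EuclideanSpace ℝ (Fin 3))
      (volume : Measure (EuclideanSpace ℝ (Fin 3))) 2 : ℝ≥0) : ℝ) ^ (3 / 2 : ℝ) with hK₁
  refine ⟨c₀, K₀, K₁, hc₀, hK₀, by positivity, ?_⟩
  intro ν T hν hT u p hcl hLH hdec x₀ r ρ R τ H hr hρ hτ hτT hH hmod φ Cg CL hφ hφc hφ0 hφ1 hone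
    hsupp hD hΔ hCg
  set A : ℝ := (Real.sqrt H + Real.sqrt (∫ x in ball x₀ R, ‖u T x‖ ^ 2)) ^ 2 with hA
  set G : ℝ := Real.sqrt (∫ x, ‖u 0 x‖ ^ 2) * Real.sqrt H / ν with hGdef
  have hG : 0 ≤ G := by positivity
  have h0 : 0 < T - τ := by linarith
  -- the local energy on the window
  have ha : ∀ s ∈ Ico (T - τ) T, ∫ x in ball x₀ R, ‖u s x‖ ^ 2 ≤ A := fun s hs =>
    CubicFlux.localEnergy_le_of_modulus hLH hT x₀ R ⟨h0.le.trans hs.1, hs.2.le⟩ hH (hmod s hs)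
  -- the window enstrophy
  have hGw := CubicFlux.windowEnstrophy_le_of_modulus hν hT hcl hLH hdec hτ hτT hH
    (hmod (T - τ) ⟨le_rfl, by linarith⟩)
  -- the gauge data
  obtain ⟨q, c, -, hq32, hpq, hsl⟩ := PressureGauge.exists_gauge_associated_pressure hT hcl hLH
  -- the pressure flux on every sub-window
  have hP : ∀ t₁ ∈ Ioo (T - τ) T,
      IntegrableOn (fun z : ℝ × EuclideanSpace ℝ (Fin 3) => |p z.1 z.2 - c z.1| * ‖u z.1 z.2‖)
          (Ioo (T - τ) t₁ ×ˢ ball x₀ R) ∧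
        ∫ z in Ioo (T - τ) t₁ ×ˢ ball x₀ R, |p z.1 z.2 - c z.1| * ‖u z.1 z.2‖ ≤
          K₁ * Real.sqrt (∫ x, ‖u 0 x‖ ^ 2) * A ^ (1 / 4 : ℝ) *
            (τ ^ (1 / 4 : ℝ) * G ^ (3 / 4 : ℝ)) := fun t₁ ht₁ => by
    have h := PressureFlux.pressureFlux_le hν.le hcl hLH x₀ R hτT ht₁ ha hG hGw hq32 hpq hsl
    refine ⟨h.1, h.2.trans_eq ?_⟩
    rw [hK₁]
  exact hB ν T hν hT u p hcl hLH hdec x₀ r ρ R τ H hr hρ hτ hτT hH hmod φ Cg CL hφ hφc hφ0 hφ1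
    hone hsupp hD hΔ hCg _ c (fun t₁ ht₁ => (hP t₁ ht₁).1) (fun t₁ ht₁ => (hP t₁ ht₁).2)

end LocalEnergyBudget

end Summit.NavierStokesRegularity.NavierStokesRegularity.Theorems

end
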